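import Mathlib
import HarnessLib
import Summits.HubbardSuperconductivity.HubbardSuperconductivity.Theorems.KLProgrammeKLRegimeEngineV8DefsG2
import Summits.HubbardSuperconductivity.HubbardSuperconductivity.Theorems.KLProgrammeKLRegimeEngineValueClauseReduction

/-!
# Route `KLProgramme` — crux K3, ENGINE child (gen 4 `KLRegimeEngineV12` stmt-HubbardSuperconductivity-19855, package `EngineV8.klEngGeo3`):
# the TRANSFER-FREE FLOOR of the two-shell gain profiles — at the registered package the value-increment clauses are SIGN-BLIND at the
# scales `n ≤ 12` (cell gate-hubbard-kl, seat hubbard-kl-k3c2-p2 «thermal-bar induction n ≤ nScales β + 1», g3)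

The (T)/(D)-carrying value-increment clauses (E2″-v6) `PairValueIncrementAtV6` and (E2′-S3) `QuarticValueIncrementAtS3` of the engine slot bound the
scale-`n` increments by `gainBar G P U n ρpp ρd ρx + eremBar + thermalBar + legDressBarQ·count`, `gainBar = (Klam U)²·(ppGain n ρpp + phGain n ρd +
phGain n ρx)`.  The package profiles (`…TwoPointLimitShellGainProfiles`) are `ppGainOf C₁ C₂ w e₀ n m ρ` and `phGainOf C₀ K C₁ C₂ w e₀ n m ρ`, both
capped at `1` and both carrying the caustic square-root term `C₂√e₀·2^{−n}` in their resolved branch, the ph profile the zero-sound constant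
`C₀4^{−n}` in its below-resolution branch.  This gives TRANSFER-FREE lower bounds:
* `klgf_ppGainOf_ge` — `min 1 (C₂√e₀/2ⁿ) ≤ ppGainOf C₁ C₂ w e₀ n m ρ` (`0 ≤ C₁`, `0 ≤ e₀`); `klgf_ppGainOf_eq_one` — `= 1` once `1 ≤ C₂√e₀/2ⁿ`;
* `klgf_phGainOf_ge` — `min 1 (min (C₀/4ⁿ) (C₂√e₀/2ⁿ)) ≤ phGainOf C₀ K C₁ C₂ w e₀ n m ρ` (`0 ≤ K`, `0 ≤ C₁`, `0 < e₀`, `0 ≤ ρ + w/4ᵐ`);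
  `klgf_phGainOf_eq_one` — `= 1` once `1 ≤ C₀/4ⁿ` and `1 ≤ C₂√e₀/2ⁿ`;
and at the REGISTERED package `klEngGeo3` (`C₀ = K = C₁ = C₂ = 2^24`, `w = 0`, `e₀ = 1/32`, so `C₂√e₀/2ⁿ ≥ 2^21/2ⁿ`, `C₀/4ⁿ = 2^24/4ⁿ`):
* **`klgf_ppGain_klEngGeo3_eq_one`** (`n ≤ 21`, every `ρ`), **`klgf_phGain_klEngGeo3_eq_one`** (`n ≤ 12`, every `ρ`),
  **`klgf_gainBar_klEngGeo3_eq`** — `n ≤ 12 ⇒ gainBar klEngGeo3 P U n ρpp ρd ρx = 3·(Klam U)²` at ALL transfers;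
* hence **`klgf_pairValueIncrementAtV6_of_signBlind`** / **`klgf_quarticValueIncrementAtS3_of_signBlind`**: at `n ≤ 12` the clauses follow from the
  SIGN-BLIND increment bound `‖𝒞_n − 𝒞_{n−1}‖ ≤ 3(Klam U)² + eremBar (n−1) + thermalBar n + legDressBarQ·count` — no channel / zero-sound / thermal
  analysis is needed there; the (T)/zero-sound chain (ZS-RECIPE) is load-bearing exactly at the deep scales `13 ≤ n ≤ nScales β + 1`.
Arithmetic on landed definitions; nothing about the model is asserted.  0 kit.
-/

noncomputable section

namespace Summit.HubbardSuperconductivity.HubbardSuperconductivity.Theorems.KLRegimeSplit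

set_option linter.dupNamespace false -- summit = problem name (single-conjunct summit), D-0017

open Real Finset Literature.MathematicalPhysics.QuantumLattice Literature.Probability.LatticeModels
open Summit.HubbardSuperconductivity.HubbardSuperconductivity.Theorems.KLProgrammeLegKernels
open Summit.HubbardSuperconductivity.HubbardSuperconductivity.Theorems.EngineV8

/-! ## §1 Transfer-free floors of the generic profiles -/

/-- **pp floor**: `min 1 (C₂√e₀/2ⁿ) ≤ ppGainOf C₁ C₂ w e₀ n m ρ` (`0 ≤ C₁`, `0 ≤ e₀`). -/
theorem klgf_ppGainOf_ge {C₁ e₀ : ℝ} (hC₁ : 0 ≤ C₁) (he₀ : 0 ≤ e₀) (C₂ w : ℝ) (n m : ℕ) (ρ : ℝ) :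
    min 1 (C₂ * Real.sqrt e₀ * ((2 : ℝ) ^ n)⁻¹) ≤ ppGainOf C₁ C₂ w e₀ n m ρ := by
  unfold ppGainOf
  split_ifs with h
  · refine min_le_min le_rfl ?_
    have : 0 ≤ C₁ * (e₀ * ((4 : ℝ) ^ n)⁻¹) / (ρ - w * ((4 : ℝ) ^ m)⁻¹) :=
      div_nonneg (mul_nonneg hC₁ (by positivity)) (by linarith)
    linarith
  · exact min_le_left _ _

/-- **pp profile saturated**: `1 ≤ C₂√e₀/2ⁿ ⇒ ppGainOf C₁ C₂ w e₀ n m ρ = 1`. -/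
theorem klgf_ppGainOf_eq_one {C₁ C₂ e₀ : ℝ} (hC₁ : 0 ≤ C₁) (he₀ : 0 ≤ e₀) {n : ℕ} (h1 : 1 ≤ C₂ * Real.sqrt e₀ * ((2 : ℝ) ^ n)⁻¹)
    (w : ℝ) (m : ℕ) (ρ : ℝ) : ppGainOf C₁ C₂ w e₀ n m ρ = 1 := by
  refine le_antisymm (klgp_ppGainOf_le_one _ _ _ _ _ _ _) ?_
  have h := klgf_ppGainOf_ge hC₁ he₀ C₂ w n m ρ
  rwa [min_eq_left h1] at h

/-- **ph floor**: `min 1 (min (C₀/4ⁿ) (C₂√e₀/2ⁿ)) ≤ phGainOf C₀ K C₁ C₂ w e₀ n m ρ` (`0 ≤ K`, `0 ≤ C₁`, `0 < e₀`, `0 ≤ ρ + w/4ᵐ`). -/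
theorem klgf_phGainOf_ge {C₀ K C₁ e₀ w ρ : ℝ} (hK : 0 ≤ K) (hC₁ : 0 ≤ C₁) (he₀ : 0 < e₀) {m : ℕ}
    (hρ : 0 ≤ ρ + w * ((4 : ℝ) ^ m)⁻¹) (C₂ : ℝ) (n : ℕ) :
    min 1 (min (C₀ * ((4 : ℝ) ^ n)⁻¹) (C₂ * Real.sqrt e₀ * ((2 : ℝ) ^ n)⁻¹)) ≤ phGainOf C₀ K C₁ C₂ w e₀ n m ρ := by
  unfold phGainOf
  refine le_min (min_le_left _ _) (le_min ?_ ?_)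
  · refine (min_le_right _ _).trans ((min_le_left _ _).trans ?_)
    have : 0 ≤ K * (ρ + w * ((4 : ℝ) ^ m)⁻¹) / e₀ * (4 : ℝ) ^ n := by positivity
    linarith
  · split_ifs with h
    · refine (min_le_right _ _).trans ((min_le_right _ _).trans ?_)
      have : 0 ≤ C₁ * (e₀ * ((4 : ℝ) ^ n)⁻¹) / (ρ - w * ((4 : ℝ) ^ m)⁻¹) :=
        div_nonneg (mul_nonneg hC₁ (by positivity)) (by linarith)
      linarith
    · exact min_le_left _ _

/-- **ph profile saturated**: `1 ≤ C₀/4ⁿ` and `1 ≤ C₂√e₀/2ⁿ ⇒ phGainOf C₀ K C₁ C₂ w e₀ n m ρ = 1`. -/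
theorem klgf_phGainOf_eq_one {C₀ K C₁ C₂ e₀ w ρ : ℝ} (hK : 0 ≤ K) (hC₁ : 0 ≤ C₁) (he₀ : 0 < e₀) {m : ℕ}
    (hρ : 0 ≤ ρ + w * ((4 : ℝ) ^ m)⁻¹) {n : ℕ} (h0 : 1 ≤ C₀ * ((4 : ℝ) ^ n)⁻¹) (h2 : 1 ≤ C₂ * Real.sqrt e₀ * ((2 : ℝ) ^ n)⁻¹) :
    phGainOf C₀ K C₁ C₂ w e₀ n m ρ = 1 := by
  refine le_antisymm (klgp_phGainOf_le_one _ _ _ _ _ _ _ _ _) ?_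
  have h := klgf_phGainOf_ge (C₀ := C₀) hK hC₁ he₀ hρ C₂ n
  rwa [min_eq_left (le_min h0 h2)] at h

/-! ## §2 The registered package `klEngGeo3`: `ppGain = 1` for `n ≤ 21`, `phGain = 1` for `n ≤ 12` -/

/-- `2^21 ≤ 2^24·√(1/32)` (indeed `√(1/32) ≥ 1/8`). -/
theorem klgf_caustic_const : (2 : ℝ) ^ 21 ≤ 2 ^ 24 * Real.sqrt (1 / 32) := by
  have h : (1 / 8 : ℝ) ≤ Real.sqrt (1 / 32) := by
    rw [show (1 / 8 : ℝ) = Real.sqrt ((1 / 8) ^ 2) by rw [Real.sqrt_sq (by norm_num)]]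
    exact Real.sqrt_le_sqrt (by norm_num)
  nlinarith

/-- For `n ≤ 21`: `1 ≤ 2^24·√klE0·2^{−n}`. -/
theorem klgf_one_le_caustic {n : ℕ} (hn : n ≤ 21) : 1 ≤ (2 : ℝ) ^ 24 * Real.sqrt klE0 * ((2 : ℝ) ^ n)⁻¹ := by
  unfold klE0
  have h1 := klgf_caustic_const
  have h2 : (2 : ℝ) ^ n ≤ 2 ^ 21 := pow_le_pow_right₀ (by norm_num) hn
  have hpos : (0 : ℝ) < 2 ^ n := by positivity
  rw [← div_eq_mul_inv, le_div_iff₀ hpos, one_mul]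
  linarith

/-- For `n ≤ 12`: `1 ≤ 2^24·4^{−n}`. -/
theorem klgf_one_le_zeroSound {n : ℕ} (hn : n ≤ 12) : 1 ≤ (2 : ℝ) ^ 24 * ((4 : ℝ) ^ n)⁻¹ := by
  have h2 : (4 : ℝ) ^ n ≤ 4 ^ 12 := pow_le_pow_right₀ (by norm_num) hn
  have hpos : (0 : ℝ) < 4 ^ n := by positivity
  rw [← div_eq_mul_inv, le_div_iff₀ hpos, one_mul]
  calc (4 : ℝ) ^ n ≤ 4 ^ 12 := h2
    _ = 2 ^ 24 := by norm_num

/-- **`klEngGeo3.ppGain n ρ = 1` for every `ρ` and every `n ≤ 21`.** -/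
theorem klgf_ppGain_klEngGeo3_eq_one {n : ℕ} (hn : n ≤ 21) (ρ : ℝ) : klEngGeo3.ppGain n ρ = 1 :=
  klgf_ppGainOf_eq_one (by norm_num) (by unfold klE0; norm_num) (klgf_one_le_caustic hn) 0 n ρ

/-- **`klEngGeo3.phGain n ρ = 1` for every `ρ` and every `n ≤ 12`.** -/
theorem klgf_phGain_klEngGeo3_eq_one {n : ℕ} (hn : n ≤ 12) (ρ : ℝ) : klEngGeo3.phGain n ρ = 1 := by
  show phGainOf (2 ^ 24) (2 ^ 24) (2 ^ 24) (2 ^ 24) 0 klE0 n n (max ρ 0) = 1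
  exact klgf_phGainOf_eq_one (by norm_num) (by norm_num) (by unfold klE0; norm_num)
    (by rw [zero_mul, add_zero]; exact le_max_right _ _) (klgf_one_le_zeroSound hn) (klgf_one_le_caustic (hn.trans (by norm_num)))

/-- **At `n ≤ 12` the gain majorant of the registered package is transfer-free**: `gainBar klEngGeo3 P U n ρpp ρd ρx = 3·(Klam U)²`. -/
theorem klgf_gainBar_klEngGeo3_eq {n : ℕ} (hn : n ≤ 12) (P : SplitConsts) (U ρpp ρd ρx : ℝ) :
    gainBar klEngGeo3 P U n ρpp ρd ρx = 3 * (P.Klam * U) ^ 2 := by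
  unfold gainBar
  rw [klgf_ppGain_klEngGeo3_eq_one (hn.trans (by norm_num)), klgf_phGain_klEngGeo3_eq_one hn, klgf_phGain_klEngGeo3_eq_one hn]
  ring

/-- At every scale the gain majorant of the registered package dominates its transfer-free floor:
`(Klam U)²·(min 1 (2^21/2ⁿ) + 2·min 1 (min (2^24/4ⁿ) (2^21/2ⁿ))) ≤ gainBar klEngGeo3 P U n ρpp ρd ρx`. -/
theorem klgf_gainBar_klEngGeo3_ge (n : ℕ) (P : SplitConsts) (U ρpp ρd ρx : ℝ) :
    (P.Klam * U) ^ 2 * (min 1 ((2 : ℝ) ^ 21 * ((2 : ℝ) ^ n)⁻¹) +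
        2 * min 1 (min ((2 : ℝ) ^ 24 * ((4 : ℝ) ^ n)⁻¹) ((2 : ℝ) ^ 21 * ((2 : ℝ) ^ n)⁻¹))) ≤
      gainBar klEngGeo3 P U n ρpp ρd ρx := by
  unfold gainBar
  have hc : (2 : ℝ) ^ 21 * ((2 : ℝ) ^ n)⁻¹ ≤ 2 ^ 24 * Real.sqrt klE0 * ((2 : ℝ) ^ n)⁻¹ := by
    unfold klE0
    exact mul_le_mul_of_nonneg_right klgf_caustic_const (by positivity)
  have hpp : min 1 ((2 : ℝ) ^ 21 * ((2 : ℝ) ^ n)⁻¹) ≤ klEngGeo3.ppGain n ρpp :=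
    (min_le_min le_rfl hc).trans (klgf_ppGainOf_ge (by norm_num) (by unfold klE0; norm_num) _ _ _ _ _)
  have hph : ∀ ρ : ℝ, min 1 (min ((2 : ℝ) ^ 24 * ((4 : ℝ) ^ n)⁻¹) ((2 : ℝ) ^ 21 * ((2 : ℝ) ^ n)⁻¹)) ≤ klEngGeo3.phGain n ρ := by
    intro ρ
    show _ ≤ phGainOf (2 ^ 24) (2 ^ 24) (2 ^ 24) (2 ^ 24) 0 klE0 n n (max ρ 0)
    refine (min_le_min le_rfl (min_le_min le_rfl hc)).trans ?_
    exact klgf_phGainOf_ge (by norm_num) (by norm_num) (by unfold klE0; norm_num)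
      (by rw [zero_mul, add_zero]; exact le_max_right _ _) _ _
  have h1 := hph ρd
  have h2 := hph ρx
  have hsq : 0 ≤ (P.Klam * U) ^ 2 := sq_nonneg _
  nlinarith

/-! ## §3 The value-increment clauses are SIGN-BLIND at `n ≤ 12` -/

section Model

variable {L M : ℕ} [NeZero L] [NeZero M]

/-- **(E2″-v6) at `n ≤ 12` from a sign-blind increment bound**: if `‖𝒞_n(Q;k,k′) − 𝒞_{n−1}(Q;k,k′)‖ ≤ 3(Klam U)² + eremBar (n−1) + thermalBar n +
legDressBarQ·count` on the ball for every `Q`, then `PairValueIncrementAtV6 L M klEngGeo3 P Q β U μ K n`. -/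
theorem klgf_pairValueIncrementAtV6_of_signBlind {P : SplitConsts} {Q : EngConsts} {β U μ : ℝ} {K : TrigPolyC4v} {n : ℕ} (hn : n ≤ 12)
    (h : 1 ≤ n → ∀ Qm : TorusSite 2 L, ∀ k ∈ klBall L μ K, ∀ k' ∈ klBall L μ K,
      ‖klPairAmplitude L M β U μ K n Qm k k' - klPairAmplitude L M β U μ K (n - 1) Qm k k'‖ ≤
        3 * (P.Klam * U) ^ 2 + eremBar klEngGeo3 P Q U β L (n - 1) + thermalBar klEngGeo3 P U β n +
          legDressBarQ klEngGeo3 P Q U n (legSliceCountT L β μ K n ![k', Qm - k', Qm - k, k])) :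
    PairValueIncrementAtV6 L M klEngGeo3 P Q β U μ K n := by
  intro hn1 Qm k hk k' hk'
  rw [klgf_gainBar_klEngGeo3_eq hn]
  exact h hn1 Qm k hk k' hk'

/-- **(E2′-S3) at `n ≤ 12` from the same sign-blind bound** (through `klvr_quarticValueIncrementAtS3_of_pairValueIncrementAtV6`). -/
theorem klgf_quarticValueIncrementAtS3_of_signBlind {P : SplitConsts} {Q : EngConsts} {β U μ : ℝ} {K : TrigPolyC4v} {n : ℕ} (hn : n ≤ 12)
    (h : 1 ≤ n → ∀ Qm : TorusSite 2 L, ∀ k ∈ klBall L μ K, ∀ k' ∈ klBall L μ K,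
      ‖klPairAmplitude L M β U μ K n Qm k k' - klPairAmplitude L M β U μ K (n - 1) Qm k k'‖ ≤
        3 * (P.Klam * U) ^ 2 + eremBar klEngGeo3 P Q U β L (n - 1) + thermalBar klEngGeo3 P U β n +
          legDressBarQ klEngGeo3 P Q U n (legSliceCountT L β μ K n ![k', Qm - k', Qm - k, k])) :
    QuarticValueIncrementAtS3 L M klEngGeo3 P Q β U μ K n :=
  klvr_quarticValueIncrementAtS3_of_pairValueIncrementAtV6 (klgf_pairValueIncrementAtV6_of_signBlind hn h)

/-- **At every scale, a sign-blind increment bound against the transfer-free floor suffices for (E2″-v6)** (the floor is `3` for `n ≤ 12`,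
`≥ 2·4^{12−n} + …` beyond): if `‖𝒞_n − 𝒞_{n−1}‖ ≤ (Klam U)²·floor(n) + eremBar + thermalBar + legDressBarQ·count` then the clause holds. -/
theorem klgf_pairValueIncrementAtV6_of_floor {P : SplitConsts} {Q : EngConsts} {β U μ : ℝ} {K : TrigPolyC4v} {n : ℕ}
    (h : 1 ≤ n → ∀ Qm : TorusSite 2 L, ∀ k ∈ klBall L μ K, ∀ k' ∈ klBall L μ K,
      ‖klPairAmplitude L M β U μ K n Qm k k' - klPairAmplitude L M β U μ K (n - 1) Qm k k'‖ ≤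
        (P.Klam * U) ^ 2 * (min 1 ((2 : ℝ) ^ 21 * ((2 : ℝ) ^ n)⁻¹) +
            2 * min 1 (min ((2 : ℝ) ^ 24 * ((4 : ℝ) ^ n)⁻¹) ((2 : ℝ) ^ 21 * ((2 : ℝ) ^ n)⁻¹))) +
          eremBar klEngGeo3 P Q U β L (n - 1) + thermalBar klEngGeo3 P U β n +
          legDressBarQ klEngGeo3 P Q U n (legSliceCountT L β μ K n ![k', Qm - k', Qm - k, k])) :
    PairValueIncrementAtV6 L M klEngGeo3 P Q β U μ K n := by
  intro hn1 Qm k hk k' hk'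
  have h1 := h hn1 Qm k hk k' hk'
  have h2 := klgf_gainBar_klEngGeo3_ge n P U (klTorusNorm L Qm) (klTorusNorm L (k - k')) (klTorusNorm L (k + k' - Qm))
  linarith

end Model

end Summit.HubbardSuperconductivity.HubbardSuperconductivity.Theorems.KLRegimeSplit

end
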